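import Mathlib
import Literature.Combinatorics.Optimization.LPRelaxationsMaxCSP
import Literature.Combinatorics.Optimization.PatternMatrixRankUpperBounds
import HarnessLib

/-!
# rank₊(C₃) = 8 — the 8 × 8 unique-disjointness value matrix has full nonnegative rank
(kernel-checked certificate; cell val-cor-slack D-0160, custody lead g3; calibration instrument for crux stmt-ValiantsHypothesis-21181 `NNDivisionHard` — a finite exact fact, NOT law evidence)

`C₃(a,b) = (1 − |a ∩ b|)²`, `a, b ⊆ {1,2,3}` — the Kaibel–Weltge / unique-disjointness submatrix of the slack matrix
of the correlation polytope `COR(3)` (rows: vertices `bbᵀ`; columns: the valid inequalities obtained by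
multilinearising `(1 − Σ_{i∈a} x_i)² ≥ 0`).  `rank₊(C_n) = 2^n` for all `n` is Conjecture 4 of
Vandaele–Gillis–Glineur–Tuyttens (arXiv:1411.7245); `7 ≤ rank₊(C₃) ≤ 8` is the printed state of the case `n = 3`
(cf. arXiv:2605.14058, Table 9).  This file decides it: `rank₊(C₃) = 8`.

## Main statements
* `nonnegRank_C3`  : `HasNonnegFactorization C3r 8 ∧ ∀ r, HasNonnegFactorization C3r r → 8 ≤ r` (table form);
* `nonnegRank_ud3` : the same for `ud3 a b = (1 − |a ∩ b|)²` on `Finset (Fin 3)` (set form);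
* `not_hasNonnegFactorization_seven` : the lower bound `¬ HasNonnegFactorization C3r 7`.
`HasNonnegFactorization` is the tree's `Literature.Combinatorics.Optimization.HasNonnegFactorization`
(`M = Σ_{l<r} u_l v_lᵀ`, `u_l, v_l ≥ 0`).  Axioms: `propext`, `Classical.choice`, `Quot.sound` only (guarded below);
no `native_decide`; the `decide` steps are pointwise statements over `Fin 8`/`Fin 7`/`Fin 6 → Bool` (largest: `cover`,
64 × 5 shape assignments).

## Certificate (val-cor-slack cell D-0160, lead g3; a NEW certificate shape, not the cover enumeration of record)
1. FOOLING SET `F = {(a, ā) : ∅ ≠ a ≠ 123} ∪ {(123,123)}` (`fa`, `fb`; `f_pos`, `f_fool`): in a nonnegative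
   factorisation with 7 terms every term owns exactly one cell of `F` (`own`, a bijection `Fin 7 → Fin 7`).
2. SHAPE DICHOTOMY (`dich6`): the owner of `(a, ā)` has row support `⊆ {∅, a}` ("row type") or column support
   `⊆ {∅, ā}` ("column type"); the owner of `(123,123)` (`dich7`, `supp7`) is of row type `{∅,123} × ·`, of column
   type, or a principal block on `{∅, k, 123}`, `|k| = 2`.
3. COVER (`cover`, by `decide`): among the `2⁶ × 5` shape assignments only ROW STAR (all row type) and COLUMN STAR
   (all column type) cover `supp C₃`.
4. CONE STEP (`rowstar_false`, `colstar_false`): in the row star each nonempty row `a` is carried by its owner alone,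
   so the all-ones row `C₃[∅,·]` is a nonnegative combination `Σ_a d_a C₃[a,·]`; pairing with `y(b) = 4, −2, 0, −1`
   for `|b| = 0,1,2,3` (columns `∅,{1},{2},{3},{123}` suffice) gives `−3 = d_{12} + d_{13} + d_{23} ≥ 0`. `linarith`.
   The column star is the transpose.

Finite exact fact / calibration instrument for the cell's law tests — NOT evidence for any asymptotic law;
VP ≠ VNP is NOT proved here or anywhere in this cell.
-/

set_option linter.dupNamespace false

open Finset
open Literature.Combinatorics.Optimization (HasNonnegFactorization)

namespace Summit.ValiantsHypothesis.ValiantsHypothesis.Cruxes.NNDivisionHard.RankPlusC3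

/-- `C₃` as an explicit table. Index `i : Fin 8` encodes the subset `{k+1 : bit k of i is set}` of `{1,2,3}`:
0 = ∅, 1 = {1}, 2 = {2}, 3 = {1,2}, 4 = {3}, 5 = {1,3}, 6 = {2,3}, 7 = {1,2,3}. Entry = (1 − |a ∩ b|)². -/
def C3 : Fin 8 → Fin 8 → ℕ :=
  ![![1, 1, 1, 1, 1, 1, 1, 1],
    ![1, 0, 1, 0, 1, 0, 1, 0],
    ![1, 1, 0, 0, 1, 1, 0, 0],
    ![1, 0, 0, 1, 1, 0, 0, 1],
    ![1, 1, 1, 1, 0, 0, 0, 0],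
    ![1, 0, 1, 0, 0, 1, 0, 1],
    ![1, 1, 0, 0, 0, 0, 1, 1],
    ![1, 0, 0, 1, 0, 1, 1, 4]]

/-- the real matrix -/
def C3r (i j : Fin 8) : ℝ := C3 i j

/-- bit-count of the bitwise AND, by table (= |a ∩ b| under the encoding) -/
def interCard : Fin 8 → Fin 8 → ℕ :=
  fun a b => ((Nat.land a.val b.val).testBit 0).toNat + ((Nat.land a.val b.val).testBit 1).toNat +
    ((Nat.land a.val b.val).testBit 2).toNat

/-- meaning of the table: `C3 a b = (1 − |a ∩ b|)²` (computed in ℤ). -/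
theorem C3_eq : ∀ a b : Fin 8, (C3 a b : ℤ) = (1 - (interCard a b : ℤ)) ^ 2 := by decide

/-! ## the fooling set: cells (a, ā) for the six proper nonempty a, and (123,123) -/
def fa : Fin 7 → Fin 8 := ![1, 2, 3, 4, 5, 6, 7]
def fb : Fin 7 → Fin 8 := ![6, 5, 4, 3, 2, 1, 7]

theorem f_pos : ∀ t : Fin 7, C3 (fa t) (fb t) ≠ 0 := by decide

theorem f_fool : ∀ t t' : Fin 7, t ≠ t' → C3 (fa t) (fb t') = 0 ∨ C3 (fa t') (fb t) = 0 := by decide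

theorem fa_succ : ∀ t : Fin 7, (fa t).val = t.val + 1 := by decide

/-! ## support-shape dichotomies (pointwise, decidable) -/
theorem dich6 : ∀ t : Fin 7, t ≠ 6 → ∀ i j : Fin 8, C3 i (fb t) ≠ 0 → C3 (fa t) j ≠ 0 → C3 i j ≠ 0 →
    (i = 0 ∨ i = fa t) ∨ (j = 0 ∨ j = fb t) := by decide

theorem dich7 : ∀ i j : Fin 8, C3 i 7 ≠ 0 → C3 7 j ≠ 0 → C3 i j ≠ 0 →
    i ≠ 0 → i ≠ 7 → j ≠ 0 → j ≠ 7 → i = j := by decide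

theorem supp7 : ∀ i : Fin 8, C3 i 7 ≠ 0 → i ≠ 0 → i ≠ 7 → i = 3 ∨ i = 5 ∨ i = 6 := by decide

theorem C3_symm : ∀ i j : Fin 8, C3 i j = C3 j i := by decide

/-! ## the covering lemma: shapes of the seven owner terms -/
/-- membership of cell (i,j) in the enclosing rectangle of the term owning fooling cell `t`, given the shape bits
`c t` (for t < 6: `false` = row type `{∅, a_t} × supp(row a_t)`, `true` = column type) and the 5-way type `r` of the
seventh term (0 = row type, 4 = column type, 1/2/3 = the square `{∅, k, 123}²` for k = {1,2}, {1,3}, {2,3}). -/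
def rectB (c : Fin 7 → Bool) (r : Fin 5) (t : Fin 7) (i j : Fin 8) : Bool :=
  if t = 6 then
    (if r = 0 then ((i == 0 || i == 7) && C3 7 j != 0)
     else if r = 4 then (C3 i 7 != 0 && (j == 0 || j == 7))
     else if r = 1 then ((i == 0 || i == 3 || i == 7) && (j == 0 || j == 3 || j == 7))
     else if r = 2 then ((i == 0 || i == 5 || i == 7) && (j == 0 || j == 5 || j == 7))
     else ((i == 0 || i == 6 || i == 7) && (j == 0 || j == 6 || j == 7)))
  else
    (if c t then (C3 i (fb t) != 0 && (j == 0 || j == fb t)) else ((i == 0 || i == fa t) && C3 (fa t) j != 0))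

theorem cover : ∀ c : Fin 6 → Bool, ∀ r : Fin 5,
    (∀ i j : Fin 8, C3 i j ≠ 0 → ∃ t : Fin 7, rectB (fun t => if h : t.val < 6 then c ⟨t.val, h⟩ else false) r t i j = true) →
    (c = (fun _ => false) ∧ r = 0) ∨ (c = (fun _ => true) ∧ r = 4) := by
  decide


/-! ## auxiliary decidable facts used by the linear-algebra endgame -/
theorem fa_ne_zero : ∀ t : Fin 7, fa t ≠ 0 := by decide
theorem fb_ne_zero : ∀ t : Fin 7, fb t ≠ 0 := by decide
theorem fa_inj : ∀ t t' : Fin 7, fa t = fa t' → t = t' := by decide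
theorem fb_inj : ∀ t t' : Fin 7, fb t = fb t' → t = t' := by decide

/-! ## the two star configurations are infeasible (cone argument with dual vector y = (4,−2,0,−1) by |b|) -/

/-- ROW STAR: if every term's row support is inside `{∅, a_t}` (term `own t` owning fooling cell `t`), the all-ones
row `C₃[∅,·]` would be a nonnegative combination of the rows `C₃[a,·]`, `a ≠ ∅` — impossible. -/
theorem rowstar_false (U : Fin 8 → Fin 7 → ℝ) (V : Fin 7 → Fin 8 → ℝ) (hU : ∀ i l, 0 ≤ U i l)
    (hM : ∀ i j, C3r i j = ∑ l, U i l * V l j) (own : Fin 7 → Fin 7) (hbij : Function.Bijective own)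
    (hpos : ∀ t, 0 < U (fa t) (own t)) (hRow : ∀ t i, 0 < U i (own t) → i = 0 ∨ i = fa t) : False := by
  -- off-owner entries of the nonempty rows vanish
  have hoff : ∀ t t', t' ≠ t → U (fa t) (own t') = 0 := by
    intro t t' hne
    rcases (hU (fa t) (own t')).eq_or_lt with h | h
    · exact h.symm
    · rcases hRow t' (fa t) h with h0 | h1
      · exact absurd h0 (fa_ne_zero t)
      · exact absurd (fa_inj t t' h1) (Ne.symm hne)
  -- nonempty rows are single terms
  have hrow : ∀ t j, C3r (fa t) j = U (fa t) (own t) * V (own t) j := by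
    intro t j
    rw [hM, Finset.sum_eq_single (own t)]
    · intro l _ hl
      obtain ⟨t', rfl⟩ := hbij.2 l
      have : t' ≠ t := fun h => hl (by rw [h])
      rw [hoff t t' this, zero_mul]
    · intro h; exact absurd (Finset.mem_univ _) h
  -- the all-ones row, re-indexed over owners
  have hone : ∀ j, (1 : ℝ) = ∑ t, U 0 (own t) * V (own t) j := by
    intro j
    have h1 : C3r 0 j = 1 := by
      fin_cases j <;> simp [C3r, C3]
    rw [← h1, hM]
    exact (hbij.sum_comp (fun l => U 0 l * V l j)).symm
  -- substitute V (own t) j = C3r (fa t) j / U (fa t) (own t)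
  set d : Fin 7 → ℝ := fun t => U 0 (own t) / U (fa t) (own t) with hd
  have hdnn : ∀ t, 0 ≤ d t := fun t => div_nonneg (hU 0 (own t)) (hpos t).le
  have hV : ∀ t j, V (own t) j = C3r (fa t) j / U (fa t) (own t) := by
    intro t j
    rw [eq_div_iff (hpos t).ne', hrow t j]; ring
  have hcol : ∀ j, (1 : ℝ) = ∑ t, d t * C3r (fa t) j := by
    intro j
    rw [hone j]
    refine Finset.sum_congr rfl fun t _ => ?_
    rw [hV t j, hd]
    beta_reduce
    rw [div_mul_eq_mul_div, mul_div_assoc]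
  have e0 := hcol 0
  have e1 := hcol 1
  have e2 := hcol 2
  have e4 := hcol 4
  have e7 := hcol 7
  simp [Fin.sum_univ_seven, C3r, C3, fa] at e0 e1 e2 e4 e7
  have h0 := hdnn 0; have h1 := hdnn 1; have h2 := hdnn 2; have h3 := hdnn 3
  have h4 := hdnn 4; have h5 := hdnn 5; have h6 := hdnn 6
  linarith

/-- COLUMN STAR: the transpose situation. -/
theorem colstar_false (U : Fin 8 → Fin 7 → ℝ) (V : Fin 7 → Fin 8 → ℝ) (hV : ∀ l j, 0 ≤ V l j)
    (hM : ∀ i j, C3r i j = ∑ l, U i l * V l j) (own : Fin 7 → Fin 7) (hbij : Function.Bijective own)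
    (hpos : ∀ t, 0 < V (own t) (fb t)) (hCol : ∀ t j, 0 < V (own t) j → j = 0 ∨ j = fb t) : False := by
  have hoff : ∀ t t', t' ≠ t → V (own t') (fb t) = 0 := by
    intro t t' hne
    rcases (hV (own t') (fb t)).eq_or_lt with h | h
    · exact h.symm
    · rcases hCol t' (fb t) h with h0 | h1
      · exact absurd h0 (fb_ne_zero t)
      · exact absurd (fb_inj t t' h1) (Ne.symm hne)
  have hcolumn : ∀ t i, C3r i (fb t) = U i (own t) * V (own t) (fb t) := by
    intro t i
    rw [hM, Finset.sum_eq_single (own t)]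
    · intro l _ hl
      obtain ⟨t', rfl⟩ := hbij.2 l
      have : t' ≠ t := fun h => hl (by rw [h])
      rw [hoff t t' this, mul_zero]
    · intro h; exact absurd (Finset.mem_univ _) h
  have hone : ∀ i, (1 : ℝ) = ∑ t, U i (own t) * V (own t) 0 := by
    intro i
    have h1 : C3r i 0 = 1 := by
      fin_cases i <;> simp [C3r, C3]
    rw [← h1, hM]
    exact (hbij.sum_comp (fun l => U i l * V l 0)).symm
  set d : Fin 7 → ℝ := fun t => V (own t) 0 / V (own t) (fb t) with hd
  have hdnn : ∀ t, 0 ≤ d t := fun t => div_nonneg (hV (own t) 0) (hpos t).le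
  have hU' : ∀ t i, U i (own t) = C3r i (fb t) / V (own t) (fb t) := by
    intro t i
    rw [eq_div_iff (hpos t).ne', hcolumn t i]
  have hrow : ∀ i, (1 : ℝ) = ∑ t, d t * C3r i (fb t) := by
    intro i
    rw [hone i]
    refine Finset.sum_congr rfl fun t _ => ?_
    rw [hU' t i, hd]
    beta_reduce
    rw [div_mul_eq_mul_div, div_mul_eq_mul_div, mul_comm]
  have e0 := hrow 0
  have e1 := hrow 1
  have e2 := hrow 2
  have e4 := hrow 4
  have e7 := hrow 7
  simp [Fin.sum_univ_seven, C3r, C3, fb] at e0 e1 e2 e4 e7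
  have h0 := hdnn 0; have h1 := hdnn 1; have h2 := hdnn 2; have h3 := hdnn 3
  have h4 := hdnn 4; have h5 := hdnn 5; have h6 := hdnn 6
  linarith

/-! ## the main theorem -/

/-- **rank₊(C₃) ≥ 8**: `C₃` has no nonnegative factorisation with 7 (or fewer) rank-one terms. -/
theorem not_hasNonnegFactorization_seven : ¬ HasNonnegFactorization C3r 7 := by
  rintro ⟨U, V, hU, hV, hM⟩
  have hsum : ∀ i j, (C3 i j : ℝ) = ∑ l, U i l * V l j := fun i j => hM i j
  have tnn : ∀ i j l, 0 ≤ U i l * V l j := fun i j l => mul_nonneg (hU i l) (hV l j)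
  -- zero cells kill every term there
  have zero_cell : ∀ i j, C3 i j = 0 → ∀ l, U i l = 0 ∨ V l j = 0 := by
    intro i j h l
    have hs : ∑ l, U i l * V l j = 0 := by rw [← hsum]; simp [h]
    exact mul_eq_zero.1 ((Finset.sum_eq_zero_iff_of_nonneg (fun l _ => tnn i j l)).1 hs l (Finset.mem_univ _))
  have zf : ∀ l i j, 0 < U i l → 0 < V l j → C3 i j ≠ 0 := by
    intro l i j hu hv h
    rcases zero_cell i j h l with h' | h' <;> linarith
  -- support cells are touched by some term
  have pos_cell : ∀ i j, C3 i j ≠ 0 → ∃ l, 0 < U i l ∧ 0 < V l j := by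
    intro i j h
    by_contra hc
    push Not at hc
    apply h
    have hs : ∑ l, U i l * V l j = 0 := by
      apply Finset.sum_eq_zero
      intro l _
      rcases (hU i l).eq_or_lt with hu | hu
      · rw [← hu, zero_mul]
      · have : V l j = 0 := le_antisymm (hc l hu) (hV l j)
        rw [this, mul_zero]
    have : (C3 i j : ℝ) = 0 := by rw [hsum]; exact hs
    exact_mod_cast this
  -- owners of the fooling cells: an injective, hence bijective, map Fin 7 → Fin 7
  choose own hown using fun t => pos_cell (fa t) (fb t) (f_pos t)
  have own_inj : Function.Injective own := by
    intro t t' h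
    by_contra hne
    rcases f_fool t t' hne with hz | hz
    · exact zf (own t) (fa t) (fb t') (hown t).1 (by rw [h]; exact (hown t').2) hz
    · exact zf (own t') (fa t') (fb t) (hown t').1 (by rw [← h]; exact (hown t).2) hz
  have own_surj : Function.Surjective own := Finite.surjective_of_injective own_inj
  have own_bij : Function.Bijective own := ⟨own_inj, own_surj⟩
  -- shapes of the six owners of the cells (a, ā)
  have dich : ∀ t, t ≠ 6 → (∀ i, 0 < U i (own t) → i = 0 ∨ i = fa t) ∨ (∀ j, 0 < V (own t) j → j = 0 ∨ j = fb t) := by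
    intro t ht
    by_cases hR : ∀ i, 0 < U i (own t) → i = 0 ∨ i = fa t
    · exact Or.inl hR
    · right
      push Not at hR
      obtain ⟨i, hi, hi0, hia⟩ := hR
      intro j hj
      rcases dich6 t ht i j (zf _ _ _ hi (hown t).2) (zf _ _ _ (hown t).1 hj) (zf _ _ _ hi hj) with h | h
      · rcases h with h | h
        · exact absurd h hi0
        · exact absurd h hia
      · exact h
  -- shape of the owner of (123,123)
  have fa6 : fa 6 = 7 := by decide
  have fb6 : fb 6 = 7 := by decide
  have hu7 : 0 < U 7 (own 6) := by have h := (hown 6).1; rwa [fa6] at h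
  have hv7 : 0 < V (own 6) 7 := by have h := (hown 6).2; rwa [fb6] at h
  have key7 : ∀ i j, 0 < U i (own 6) → 0 < V (own 6) j → i ≠ 0 → i ≠ 7 → j ≠ 0 → j ≠ 7 → i = j :=
    fun i j hi hj => dich7 i j (zf _ _ _ hi hv7) (zf _ _ _ hu7 hj) (zf _ _ _ hi hj)
  -- the shape bits of the six, as a Bool vector
  let c : Fin 6 → Bool := fun s => decide ¬ (∀ i, 0 < U i (own (Fin.castSucc s)) → i = 0 ∨ i = fa (Fin.castSucc s))
  let cf : Fin 7 → Bool := fun t => if h : t.val < 6 then c ⟨t.val, h⟩ else false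
  -- every support cell lies in the rectangle of the owner of some fooling cell
  have hcov : ∀ r : Fin 5, (∀ i j, 0 < U i (own 6) → 0 < V (own 6) j → rectB cf r 6 i j = true) →
      ∀ i j : Fin 8, C3 i j ≠ 0 → ∃ t : Fin 7, rectB cf r t i j = true := by
    intro r h7 i j hij
    obtain ⟨l, hu, hv⟩ := pos_cell i j hij
    obtain ⟨t, rfl⟩ := own_surj l
    refine ⟨t, ?_⟩
    by_cases ht : t = 6
    · subst ht; exact h7 i j hu hv
    · have htv : t.val < 6 := by
        have := t.isLt
        have : t.val ≠ 6 := fun h => ht (Fin.ext h)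
        omega
      have hcs : Fin.castSucc (⟨t.val, htv⟩ : Fin 6) = t := Fin.ext rfl
      rcases dich t ht with hRt | hCt
      · have hcf : cf t = false := by
          simp only [cf, htv, dif_pos, c, hcs, decide_eq_false_iff_not, not_not]
          exact hRt
        have h1 : i = 0 ∨ i = fa t := hRt i hu
        have h2 : C3 (fa t) j ≠ 0 := zf _ _ _ (hown t).1 hv
        simp only [rectB, ht, if_false, hcf]
        simpa using And.intro h1 h2
      · by_cases hRt : ∀ i, 0 < U i (own t) → i = 0 ∨ i = fa t
        · have hcf : cf t = false := by
            simp only [cf, htv, dif_pos, c, hcs, decide_eq_false_iff_not, not_not]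
            exact hRt
          have h1 : i = 0 ∨ i = fa t := hRt i hu
          have h2 : C3 (fa t) j ≠ 0 := zf _ _ _ (hown t).1 hv
          simp only [rectB, ht, if_false, hcf]
          simpa using And.intro h1 h2
        · have hcf : cf t = true := by
            simp only [cf, htv, dif_pos, c, hcs, decide_eq_true_eq]
            exact hRt
          have h1 : C3 i (fb t) ≠ 0 := zf _ _ _ hu (hown t).2
          have h2 : j = 0 ∨ j = fb t := hCt j hv
          simp only [rectB, ht, if_false, hcf]
          simpa using And.intro h1 h2
  -- reading off the conclusion of `cover`
  have rows_of : (c = fun _ => false) → ∀ t, t ≠ 6 → ∀ i, 0 < U i (own t) → i = 0 ∨ i = fa t := by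
    intro hc t ht i hi
    have htv : t.val < 6 := by
      have := t.isLt
      have : t.val ≠ 6 := fun h => ht (Fin.ext h)
      omega
    have h := congrFun hc ⟨t.val, htv⟩
    have hcs : Fin.castSucc (⟨t.val, htv⟩ : Fin 6) = t := Fin.ext rfl
    simp only [c, hcs, decide_eq_false_iff_not, not_not] at h
    exact h i hi
  have cols_of : (c = fun _ => true) → ∀ t, t ≠ 6 → ∀ j, 0 < V (own t) j → j = 0 ∨ j = fb t := by
    intro hc t ht j hj
    have htv : t.val < 6 := by
      have := t.isLt
      have : t.val ≠ 6 := fun h => ht (Fin.ext h)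
      omega
    have h := congrFun hc ⟨t.val, htv⟩
    have hcs : Fin.castSucc (⟨t.val, htv⟩ : Fin 6) = t := Fin.ext rfl
    simp only [c, hcs, decide_eq_true_eq] at h
    rcases dich t ht with hR | hC
    · exact absurd hR h
    · exact hC j hj
  -- case R: the seventh term is of row type `{∅,123} × supp(row 123)`
  by_cases hR7 : ∀ i, 0 < U i (own 6) → i = 0 ∨ i = 7
  · have h7 : ∀ i j, 0 < U i (own 6) → 0 < V (own 6) j → rectB cf 0 6 i j = true := by
      intro i j hi hj
      have h1 := hR7 i hi
      have h2 : C3 7 j ≠ 0 := zf _ _ _ hu7 hj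
      simp only [rectB]
      simpa [or_assoc] using And.intro h1 h2
    rcases cover c 0 (hcov 0 h7) with ⟨hc, _⟩ | ⟨_, hr⟩
    · refine rowstar_false U V hU hM own own_bij (fun t => (hown t).1) ?_
      intro t i hi
      by_cases ht : t = 6
      · subst ht; rw [fa6]; exact hR7 i hi
      · exact rows_of hc t ht i hi
    · exact absurd hr (by decide)
  -- case C: the seventh term is of column type
  by_cases hC7 : ∀ j, 0 < V (own 6) j → j = 0 ∨ j = 7
  · have h7 : ∀ i j, 0 < U i (own 6) → 0 < V (own 6) j → rectB cf 4 6 i j = true := by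
      intro i j hi hj
      have h1 : C3 i 7 ≠ 0 := zf _ _ _ hi hv7
      have h2 := hC7 j hj
      simp only [rectB]
      simpa [or_assoc] using And.intro h1 h2
    rcases cover c 4 (hcov 4 h7) with ⟨_, hr⟩ | ⟨hc, _⟩
    · exact absurd hr (by decide)
    · refine colstar_false U V hV hM own own_bij (fun t => (hown t).2) ?_
      intro t j hj
      by_cases ht : t = 6
      · subst ht; rw [fb6]; exact hC7 j hj
      · exact cols_of hc t ht j hj
  -- case P: the seventh term is a principal block `{∅,k,123}²`, `k ∈ {12,13,23}` — then no cover exists at all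
  push Not at hR7 hC7
  obtain ⟨i0, hi0, hi00, hi07⟩ := hR7
  obtain ⟨j0, hj0, hj00, hj07⟩ := hC7
  have e := key7 i0 j0 hi0 hj0 hi00 hi07 hj00 hj07
  have hP1 : ∀ i, 0 < U i (own 6) → i = 0 ∨ i = i0 ∨ i = 7 := by
    intro i hi
    by_cases h0 : i = 0
    · exact Or.inl h0
    by_cases h7 : i = 7
    · exact Or.inr (Or.inr h7)
    exact Or.inr (Or.inl ((key7 i j0 hi hj0 h0 h7 hj00 hj07).trans e.symm))
  have hP2 : ∀ j, 0 < V (own 6) j → j = 0 ∨ j = i0 ∨ j = 7 := by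
    intro j hj
    by_cases h0 : j = 0
    · exact Or.inl h0
    by_cases h7 : j = 7
    · exact Or.inr (Or.inr h7)
    exact Or.inr (Or.inl (key7 i0 j hi0 hj hi00 hi07 h0 h7).symm)
  have hk := supp7 i0 (zf _ _ _ hi0 hv7) hi00 hi07
  obtain ⟨r, hr0, hr4, hrect⟩ : ∃ r : Fin 5, r ≠ 0 ∧ r ≠ 4 ∧
      ∀ i j, 0 < U i (own 6) → 0 < V (own 6) j → rectB cf r 6 i j = true := by
    rcases hk with hk | hk | hk
    · refine ⟨1, by decide, by decide, fun i j hi hj => ?_⟩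
      have h1 := hP1 i hi
      have h2 := hP2 j hj
      rw [hk] at h1 h2
      simp only [rectB]
      simpa [or_assoc] using And.intro h1 h2
    · refine ⟨2, by decide, by decide, fun i j hi hj => ?_⟩
      have h1 := hP1 i hi
      have h2 := hP2 j hj
      rw [hk] at h1 h2
      simp only [rectB]
      simpa [or_assoc] using And.intro h1 h2
    · refine ⟨3, by decide, by decide, fun i j hi hj => ?_⟩
      have h1 := hP1 i hi
      have h2 := hP2 j hj
      rw [hk] at h1 h2
      simp only [rectB]
      simpa [or_assoc] using And.intro h1 h2
  rcases cover c r (hcov r hrect) with ⟨_, h⟩ | ⟨_, h⟩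
  · exact hr0 h
  · exact hr4 h


/-! ## upper bound and the exact value -/

/-- Every entrywise-nonnegative matrix with finitely many rows has a nonnegative factorisation of size `#rows`
(identity × matrix). -/
theorem hasNonnegFactorization_card_rows {ι κ : Type*} [Fintype ι] [DecidableEq ι] (M : ι → κ → ℝ)
    (hM : ∀ i j, 0 ≤ M i j) : HasNonnegFactorization M (Fintype.card ι) :=
  Literature.Combinatorics.Optimization.hasNonnegFactorization_of_fintype
    (fun i a => if i = a then (1 : ℝ) else 0) M
    (by intro i a; split_ifs <;> norm_num) hM
    (fun i j => by simp [ite_mul, Finset.sum_ite_eq])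

/-- `rank₊(C₃) ≤ 8` (trivially: 8 rows). -/
theorem hasNonnegFactorization_eight : HasNonnegFactorization C3r 8 := by
  have h := hasNonnegFactorization_card_rows C3r (fun i j => by unfold C3r; positivity)
  simpa using h

/-- **rank₊(C₃) = 8**: a nonnegative factorisation of size 8 exists, and none of any size `r ≤ 7`. -/
theorem nonnegRank_C3 : HasNonnegFactorization C3r 8 ∧ ∀ r, HasNonnegFactorization C3r r → 8 ≤ r := by
  refine ⟨hasNonnegFactorization_eight, fun r hr => ?_⟩
  by_contra h
  exact not_hasNonnegFactorization_seven (hr.mono (by omega))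

/-! ## the same fact in set language: `UD₃(a,b) = (1 − |a ∩ b|)²`, `a, b ⊆ {0,1,2}` -/

/-- The unique-disjointness / Kaibel–Weltge matrix of order 3: `(1 − |a ∩ b|)²` on subsets of a 3-set
(= the submatrix of the slack matrix of `COR(3)` with rows the vertices `bbᵀ` and columns the valid
inequalities `(1 − Σ_{i∈a} x_i)² ≥ 0` multilinearised). -/
def ud3 (a b : Finset (Fin 3)) : ℝ := (1 - ((a ∩ b).card : ℝ)) ^ 2

/-- bitmask decoding `Fin 8 → Finset (Fin 3)`. -/
def dec (i : Fin 8) : Finset (Fin 3) := Finset.univ.filter fun k => Nat.testBit i.val k.val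

theorem dec_inter_card : ∀ i j : Fin 8, ((dec i ∩ dec j).card : ℤ) = interCard i j := by decide

theorem ud3_dec (i j : Fin 8) : ud3 (dec i) (dec j) = C3r i j := by
  have h1 : (C3 i j : ℤ) = (1 - ((dec i ∩ dec j).card : ℤ)) ^ 2 := by rw [dec_inter_card]; exact C3_eq i j
  have h2 : (C3r i j) = ((C3 i j : ℤ) : ℝ) := by simp [C3r]
  rw [h2, h1]; simp [ud3]

/-- **rank₊(UD₃) = 8.** -/
theorem nonnegRank_ud3 : HasNonnegFactorization ud3 8 ∧ ∀ r, HasNonnegFactorization ud3 r → 8 ≤ r := by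
  refine ⟨?_, fun r hr => ?_⟩
  · have h := hasNonnegFactorization_card_rows ud3 (fun a b => by unfold ud3; positivity)
    simpa using h
  · refine nonnegRank_C3.2 r ?_
    obtain ⟨U, V, hU, hV, hM⟩ := hr
    exact ⟨fun i l => U (dec i) l, fun l j => V l (dec j), fun i l => hU _ _, fun l j => hV _ _,
      fun i j => by rw [← ud3_dec]; exact hM _ _⟩

end Summit.ValiantsHypothesis.ValiantsHypothesis.Cruxes.NNDivisionHard.RankPlusC3

/-! ## axiom audit (fails to elaborate if any non-standard axiom — e.g. `sorryAx`, `Lean.ofReduceBool` — were used) -/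

/-- info: 'Summit.ValiantsHypothesis.ValiantsHypothesis.Cruxes.NNDivisionHard.RankPlusC3.nonnegRank_C3' depends on axioms:
[propext, Classical.choice, Quot.sound] -/
#guard_msgs (whitespace := lax) in
#print axioms Summit.ValiantsHypothesis.ValiantsHypothesis.Cruxes.NNDivisionHard.RankPlusC3.nonnegRank_C3

/-- info: 'Summit.ValiantsHypothesis.ValiantsHypothesis.Cruxes.NNDivisionHard.RankPlusC3.nonnegRank_ud3' depends on axioms:
[propext, Classical.choice, Quot.sound] -/
#guard_msgs (whitespace := lax) in
#print axioms Summit.ValiantsHypothesis.ValiantsHypothesis.Cruxes.NNDivisionHard.RankPlusC3.nonnegRank_ud3
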